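import Mathlib

/-!
# `SnSubsetDichotomy.HyperoctahedralSubsets`, line `spherical-rank-sieve` — stub `stub_cycleCount`

Short alternating cycles force a large host intersection (crux `stmt-MatrixMultiplication-8305`,
registered stub `stub_cycleCount` of the lead's skeleton for line `spherical-rank-sieve`).

Let `μ₀, μ₂` be fixed-point-free involutions of `Fin n` (two perfect matchings `M₀, M₂`), `t > 0`,
and suppose every cycle of `π := μ₀ μ₂` is shorter than `t`.  Then
`2 ^ ⌊n / (2t)⌋ ≤ |C(μ₀) ∩ C(μ₂)|`.

Proof (elementary; no cycle-factor bookkeeping).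
* *Dihedral relations.*  `μ₀ π μ₀⁻¹ = π⁻¹`, `μ₂ = μ₀ π`, and `π y ≠ μ₀ y` (fixed-point-freeness of
  `μ₂`).  Hence `μ₀` maps `π`-cycles to `π`-cycles (`sameCycle_map`), and a point `y` is never in
  the `π`-cycle of `μ₀ y` (`not_sameCycle_apply`: if `π^j y = μ₀ y` then `π^i y` with `j = 2i` or
  `j = 2i + 1` would be a fixed point of `μ₀` resp. `μ₂`).
* *Alternating cycles.*  `R x y :⇔ (π.SameCycle x y ∨ π.SameCycle (μ₀ x) y)` ("same component of
  `M₀ ∪ M₂`") is an equivalence relation whose classes have at most `2t` elements: the class of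
  `x` is the union of the `π`-cycles of `x` and `μ₀ x`, each of size `< t` (a member of the cycle
  type) or `1` (`exists_cover_sameCycle`).  A transversal `T` (class minima) therefore has
  `n ≤ 2t |T|` (`exists_transversal`).
* *Commuting elements.*  There is a fixed-point-free map `e` commuting with `μ₀` and `π` and
  preserving every class (`exists_equivariant_fpf_map`): `e = μ₀` on the fixed points of `π`
  (digons), and on the support of `π` it is the two-step rotation of each alternating cycle,
  `e = π` on one of the two `π`-cycles of a component and `e = π⁻¹` on the other (the side being
  chosen by comparing the minima of the two cycles).  For `S ⊆ T` the permutation `G_S` that is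
  `e` on the classes of `S` and the identity elsewhere commutes with `μ₀` and `π`, hence with `μ₂`;
  and `S ↦ G_S` is injective (`G_S` moves `x ∈ T` iff `x ∈ S`).  So
  `2 ^ ⌊n/(2t)⌋ ≤ 2 ^ |T| ≤ |C(μ₀) ∩ C(μ₂)|`.

References: the count `|C(μ₀) ∩ C(μ₂)| = ∏ₖ (2k)^{c_k} c_k!` (colour-preserving automorphisms of a
union of two perfect matchings) is classical, cf. I. G. Macdonald, *Symmetric functions and Hall
polynomials* (1995), VII.2; only the elementary lower bound above is formalised here.
-/

namespace Summit.MatrixMultiplication.MatrixMultiplication.Theorems.HyperoctahedralSubsets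

open Equiv Equiv.Perm

namespace CycleCount

variable {α : Type*}

/-! ## Generic tools -/

/-- Gluing an injective map `e` on a union of `e`-stable pieces with the identity elsewhere gives an
injective map. [folklore] -/
theorem piecewise_injective (e : α → α) (Q : α → Prop) {_ : DecidablePred Q}
    (he : Function.Injective e) (hQ : ∀ y, Q (e y) ↔ Q y) :
    Function.Injective fun y => if Q y then e y else y := by
  intro y₁ y₂ h
  dsimp only at h
  by_cases h₁ : Q y₁ <;> by_cases h₂ : Q y₂
  · rw [if_pos h₁, if_pos h₂] at h; exact he h
  · rw [if_pos h₁, if_neg h₂] at h; exact absurd ((hQ y₁).2 h₁) (h ▸ h₂)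
  · rw [if_neg h₁, if_pos h₂] at h; exact absurd ((hQ y₂).2 h₂) (h ▸ h₁)
  · rwa [if_neg h₁, if_neg h₂] at h

/-- **Transversal of an equivalence relation with small classes.**  If every class of an
equivalence relation `R` on a finite linear order has at most `k` elements, the set `T` of class
minima is a transversal (`R`-related elements of `T` are equal) with `|α| ≤ |T| · k`. [folklore] -/
theorem exists_transversal [Fintype α] [LinearOrder α] (R : α → α → Prop)
    (hrefl : ∀ x, R x x) (hsymm : ∀ x y, R x y → R y x)
    (htrans : ∀ x y z, R x y → R y z → R x z) {k : ℕ}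
    (hk : ∀ x, ∃ s : Finset α, (∀ y, R x y → y ∈ s) ∧ s.card ≤ k) :
    ∃ T : Finset α, (∀ x ∈ T, ∀ x' ∈ T, R x x' → x = x') ∧ Fintype.card α ≤ T.card * k := by
  classical
  choose s hs hsk using hk
  refine ⟨Finset.univ.filter (fun x => ∀ y, R x y → x ≤ y), fun x hx x' hx' h => ?_, ?_⟩
  · simp only [Finset.mem_filter, Finset.mem_univ, true_and] at hx hx'
    exact le_antisymm (hx x' h) (hx' x (hsymm _ _ h))
  · have cover : ∀ y, ∃ x, (∀ y', R x y' → x ≤ y') ∧ R x y := fun y => by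
      have hne : (Finset.univ.filter (R y)).Nonempty := ⟨y, by simpa using hrefl y⟩
      have hm : R y ((Finset.univ.filter (R y)).min' hne) := by
        simpa using Finset.min'_mem _ hne
      exact ⟨_, fun y' h => Finset.min'_le _ _ (by simpa using htrans _ _ _ hm h), hsymm _ _ hm⟩
    calc Fintype.card α = (Finset.univ : Finset α).card := Finset.card_univ.symm
      _ ≤ ((Finset.univ.filter fun x => ∀ y, R x y → x ≤ y).biUnion s).card := by
          refine Finset.card_le_card fun y _ => ?_
          obtain ⟨x, hx, hxy⟩ := cover y
          exact Finset.mem_biUnion.2 ⟨x, by simpa using hx, hs x y hxy⟩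
      _ ≤ ∑ x ∈ Finset.univ.filter (fun x => ∀ y, R x y → x ≤ y), (s x).card :=
          Finset.card_biUnion_le
      _ ≤ ∑ _x ∈ Finset.univ.filter (fun x => ∀ y, R x y → x ≤ y), k :=
          Finset.sum_le_sum fun x _ => hsk x
      _ = _ := by rw [Finset.sum_const, smul_eq_mul]

/-- A `π`-cycle is covered by a set with at most `t` elements if every member of the cycle type of
`π` is `< t` and `0 < t` (fixed points). [folklore] -/
theorem exists_cover_sameCycle [Fintype α] [DecidableEq α] (π : Perm α) {t : ℕ} (ht : 0 < t)
    (hct : ∀ k ∈ π.cycleType, k < t) (z : α) :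
    ∃ s : Finset α, (∀ y, π.SameCycle z y → y ∈ s) ∧ s.card ≤ t := by
  by_cases hz : π z = z
  · refine ⟨{z}, fun y hy => ?_, by rw [Finset.card_singleton]; exact ht⟩
    rw [Finset.mem_singleton]
    exact (hy.eq_of_left hz).symm
  · refine ⟨(π.cycleOf z).support, fun y hy => (mem_support_cycleOf_iff' hz).2 hy,
      le_of_lt (hct _ ?_)⟩
    rw [cycleType_def, Multiset.mem_map]
    exact ⟨π.cycleOf z,
      Finset.mem_val.mpr (cycleOf_mem_cycleFactorsFinset_iff.2 (mem_support.2 hz)), rfl⟩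

/-! ## The dihedral pair `μ, π` with `μ π μ⁻¹ = π⁻¹` -/

/-- If `μ π μ⁻¹ = π⁻¹` then `μ` maps `π`-cycles to `π`-cycles. [folklore] -/
theorem sameCycle_map {μ π : Perm α} (hc : μ * π * μ⁻¹ = π⁻¹) {x y : α}
    (h : π.SameCycle x y) : π.SameCycle (μ x) (μ y) := by
  have h' := h.conj (g := μ)
  rwa [hc, sameCycle_inv] at h'

/-- **Key fact.**  If `μ π μ⁻¹ = π⁻¹`, `μ` has no fixed point and `π y ≠ μ y` for all `y`, then
`y` and `μ y` never lie in the same `π`-cycle: from `π^j y = μ y` the point `w = π^i y` satisfies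
`μ w = w` if `j = 2i` and `μ w = π w` if `j = 2i + 1`. [folklore] -/
theorem not_sameCycle_apply {μ π : Perm α} (hc : μ * π * μ⁻¹ = π⁻¹) (h1 : ∀ y, μ y ≠ y)
    (h2 : ∀ y, π y ≠ μ y) (y : α) : ¬ π.SameCycle y (μ y) := by
  rintro ⟨j, hj⟩
  have key : ∀ (i : ℤ) (z : α), μ ((π ^ i) z) = (π ^ (-i)) (μ z) := fun i z => by
    have e : μ * π ^ i * μ⁻¹ = π ^ (-i) := by rw [← conj_zpow, hc, inv_zpow, zpow_neg]
    rw [← e]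
    simp [Perm.coe_mul]
  obtain ⟨i, rfl | rfl⟩ := Int.even_or_odd' j
  · refine h1 ((π ^ i) y) ?_
    rw [key, ← hj, ← Perm.mul_apply, ← zpow_add, show -i + 2 * i = i by ring]
  · refine h2 ((π ^ i) y) ?_
    have e1 : π ((π ^ i) y) = (π ^ (1 + i)) y := by rw [zpow_one_add, Perm.mul_apply]
    have e2 : μ ((π ^ i) y) = (π ^ (1 + i)) y := by
      rw [key, ← hj, ← Perm.mul_apply, ← zpow_add, show -i + (2 * i + 1) = 1 + i by ring]
    rw [e1, e2]

/-- **The commuting fixed-point-free map.**  For an involution `μ` without fixed points and a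
permutation `π` with `μ π μ⁻¹ = π⁻¹` and `π y ≠ μ y` for all `y`, there is an injective map `e`
commuting with `μ` and `π`, without fixed points, and moving every point inside its alternating
component (`e y` lies in the `π`-cycle of `y` or of `μ y`): `e = μ` on the fixed points of `π`, and
`e = π` resp. `π⁻¹` on the two `π`-cycles of a component (distinguished by their minima; they are
distinct by `not_sameCycle_apply` and swapped by `μ`). [folklore] -/
theorem exists_equivariant_fpf_map [Fintype α] [LinearOrder α] {μ π : Perm α} (hμ : μ * μ = 1)
    (hc : μ * π * μ⁻¹ = π⁻¹) (h1 : ∀ y, μ y ≠ y) (h2 : ∀ y, π y ≠ μ y) :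
    ∃ e : α → α, Function.Injective e ∧ (∀ y, e (μ y) = μ (e y)) ∧ (∀ y, e (π y) = π (e y)) ∧
      (∀ y, e y ≠ y) ∧ ∀ y, π.SameCycle y (e y) ∨ π.SameCycle (μ y) (e y) := by
  classical
  -- pointwise relations
  have hμy : ∀ y, μ (μ y) = y := fun y => by rw [← Perm.mul_apply, hμ, Perm.one_apply]
  have hcy : ∀ y, μ (π y) = π.symm (μ y) := fun y => by
    have h := congrArg (fun σ : Perm α => σ (μ y)) hc
    simpa using h
  have hcy' : ∀ y, μ (π.symm y) = π (μ y) := fun y => by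
    have h := hcy (π.symm y)
    rw [Equiv.apply_symm_apply] at h
    exact (π.eq_symm_apply.1 h).symm
  have hfix : ∀ y, π y = y → π (μ y) = μ y := fun y hy => by
    rw [← hcy', π.symm_apply_eq.2 hy.symm]
  have hfix' : ∀ y, π y ≠ y → π (μ y) ≠ μ y := fun y hy h => hy (by simpa [hμy] using hfix _ h)
  have hπfix : ∀ y, π y ≠ y → π (π y) ≠ π y := fun y hy h => hy (π.injective h)
  have hσfix : ∀ y, π y ≠ y → π (π.symm y) ≠ π.symm y := fun y hy h => by
    rw [Equiv.apply_symm_apply] at h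
    exact hy (π.eq_symm_apply.1 h)
  have hcyc : ∀ z, π.cycleOf (π.symm z) = π.cycleOf z := fun z => by
    have h := cycleOf_self_apply π (π.symm z)
    rw [Equiv.apply_symm_apply] at h
    exact h.symm
  -- the side selector: compare the minima of the `π`-cycles of `y` and `μ y`
  obtain ⟨P, hP⟩ : ∃ P : α → Prop,
      ∀ y, P y ↔ (π.cycleOf y).support.min < (π.cycleOf (μ y)).support.min := ⟨_, fun _ => Iff.rfl⟩
  have hPπ : ∀ y, P (π y) ↔ P y := fun y => by rw [hP, hP, cycleOf_self_apply, hcy, hcyc]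
  have hPσ : ∀ y, P (π.symm y) ↔ P y := fun y => by
    have h := hPπ (π.symm y)
    rw [Equiv.apply_symm_apply] at h
    exact h.symm
  have hPμ : ∀ y, π y ≠ y → (P (μ y) ↔ ¬ P y) := fun y hy => by
    obtain ⟨a, ha⟩ := Finset.min_of_mem ((mem_support_cycleOf_iff' hy).2 (SameCycle.refl π y))
    obtain ⟨b, hb⟩ :=
      Finset.min_of_mem ((mem_support_cycleOf_iff' (hfix' y hy)).2 (SameCycle.refl π (μ y)))
    have hab : a ≠ b := by
      rintro rfl
      exact not_sameCycle_apply hc h1 h2 y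
        (((mem_support_cycleOf_iff' hy).1 (Finset.mem_of_min ha)).trans
          ((mem_support_cycleOf_iff' (hfix' y hy)).1 (Finset.mem_of_min hb)).symm)
    rw [hP, hP, hμy, ha, hb, WithTop.coe_lt_coe, WithTop.coe_lt_coe, not_lt]
    exact ⟨le_of_lt, fun h => lt_of_le_of_ne h hab.symm⟩
  refine ⟨fun y => if π y = y then μ y else if P y then π y else π.symm y, ?_, ?_, ?_, ?_, ?_⟩
  · -- injectivity
    intro y₁ y₂ h
    dsimp only at h
    by_cases k₁ : π y₁ = y₁ <;> by_cases k₂ : π y₂ = y₂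
    · rw [if_pos k₁, if_pos k₂] at h
      simpa [hμy] using congrArg μ h
    · exfalso
      rw [if_pos k₁, if_neg k₂] at h
      have h' := hfix y₁ k₁
      rw [h] at h'
      by_cases p₂ : P y₂
      · rw [if_pos p₂] at h'; exact hπfix y₂ k₂ h'
      · rw [if_neg p₂] at h'; exact hσfix y₂ k₂ h'
    · exfalso
      rw [if_neg k₁, if_pos k₂] at h
      have h' := hfix y₂ k₂
      rw [← h] at h'
      by_cases p₁ : P y₁
      · rw [if_pos p₁] at h'; exact hπfix y₁ k₁ h'
      · rw [if_neg p₁] at h'; exact hσfix y₁ k₁ h'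
    · rw [if_neg k₁, if_neg k₂] at h
      by_cases p₁ : P y₁ <;> by_cases p₂ : P y₂
      · rw [if_pos p₁, if_pos p₂] at h; exact π.injective h
      · rw [if_pos p₁, if_neg p₂] at h
        exact absurd ((hPπ y₁).2 p₁) (by rw [h, hPσ]; exact p₂)
      · rw [if_neg p₁, if_pos p₂] at h
        exact absurd ((hPπ y₂).2 p₂) (by rw [← h, hPσ]; exact p₁)
      · rw [if_neg p₁, if_neg p₂] at h; exact π.symm.injective h
  · -- commutes with `μ`
    intro y
    dsimp only
    by_cases hy : π y = y
    · rw [if_pos hy, if_pos (hfix y hy)]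
    · by_cases hp : P y
      · rw [if_neg hy, if_pos hp, if_neg (hfix' y hy), if_neg (fun h => (hPμ y hy).1 h hp)]
        exact (hcy y).symm
      · rw [if_neg hy, if_neg hp, if_neg (hfix' y hy), if_pos ((hPμ y hy).2 hp)]
        exact (hcy' y).symm
  · -- commutes with `π`
    intro y
    dsimp only
    by_cases hy : π y = y
    · rw [if_pos hy, hy, if_pos hy, hfix y hy]
    · by_cases hp : P y
      · rw [if_neg hy, if_pos hp, if_neg (hπfix y hy), if_pos ((hPπ y).2 hp)]
      · rw [if_neg hy, if_neg hp, if_neg (hπfix y hy), if_neg (fun h => hp ((hPπ y).1 h)),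
          Equiv.symm_apply_apply, Equiv.apply_symm_apply]
  · -- no fixed points
    intro y
    dsimp only
    by_cases hy : π y = y
    · rw [if_pos hy]; exact h1 y
    · by_cases hp : P y
      · rw [if_neg hy, if_pos hp]; exact hy
      · rw [if_neg hy, if_neg hp]; exact fun h => hy (π.symm_apply_eq.1 h).symm
  · -- stays in the component
    intro y
    dsimp only
    by_cases hy : π y = y
    · rw [if_pos hy]; exact Or.inr (SameCycle.refl _ _)
    · by_cases hp : P y
      · rw [if_neg hy, if_pos hp]; exact Or.inl (sameCycle_apply_right.2 (SameCycle.refl _ _))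
      · rw [if_neg hy, if_neg hp]
        exact Or.inl (sameCycle_symm_apply_right.2 (SameCycle.refl _ _))

end CycleCount

open CycleCount in
/-- **Stub `stub_cycleCount` — short alternating cycles force a large host intersection** (line
`spherical-rank-sieve` of crux `SnSubsetDichotomy.HyperoctahedralSubsets`,
stmt-MatrixMultiplication-8305).  For fixed-point-free involutions `μ₀, μ₂` of `Fin n` and `t > 0`
such that every cycle of `μ₀ μ₂` is shorter than `t`:
`2 ^ ⌊n/(2t)⌋ ≤ |C(μ₀) ⊓ C(μ₂)|`, `C(μ) = Subgroup.centralizer {μ}`.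
Proof: the alternating components (classes of `R`, see the module docstring) have `≤ 2t` points,
so a transversal `T` has `|T| ≥ n/(2t)`; the `2^{|T|}` permutations `G_S` (`S ⊆ T`), equal to the
equivariant fixed-point-free map `e` of `exists_equivariant_fpf_map` on the classes of `S` and to
the identity elsewhere, are distinct elements of `C(μ₀) ⊓ C(μ₂)`. [folklore] -/
theorem stub_cycleCount : ∀ (n : ℕ) (μ₀ μ₂ : Equiv.Perm (Fin n)), μ₀ * μ₀ = 1 → μ₂ * μ₂ = 1 → (∀ v, μ₀ v ≠ v) → (∀ v, μ₂ v ≠ v) → ∀ t : ℕ, 0 < t → (∀ k ∈ (μ₀ * μ₂).cycleType, k < t) → 2 ^ (n / (2 * t)) ≤ Nat.card ↥((Subgroup.centralizer {μ₀} : Subgroup (Equiv.Perm (Fin n))) ⊓ Subgroup.centralizer {μ₂}) := by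
  intro n μ₀ μ₂ h0 h2 f0 f2 t ht hct
  classical
  obtain ⟨π, hπ⟩ : ∃ π : Equiv.Perm (Fin n), π = μ₀ * μ₂ := ⟨_, rfl⟩
  rw [← hπ] at hct
  -- dihedral relations
  have i0 : μ₀⁻¹ = μ₀ := inv_eq_of_mul_eq_one_right h0
  have i2 : μ₂⁻¹ = μ₂ := inv_eq_of_mul_eq_one_right h2
  have hc : μ₀ * π * μ₀⁻¹ = π⁻¹ := by rw [hπ, mul_inv_rev, i0, i2, ← mul_assoc, h0, one_mul]
  have hμ2 : μ₂ = μ₀ * π := by rw [hπ, ← mul_assoc, h0, one_mul]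
  have hμy : ∀ y, μ₀ (μ₀ y) = y := fun y => by rw [← Perm.mul_apply, h0, Perm.one_apply]
  have f2' : ∀ y, π y ≠ μ₀ y := fun y h =>
    f2 y (μ₀.injective (by rwa [hπ, Perm.mul_apply] at h))
  -- the equivariant fixed-point-free map
  obtain ⟨e, einj, eμ, eπ, efpf, ecls⟩ := exists_equivariant_fpf_map h0 hc f0 f2'
  -- the relation "same alternating component"
  obtain ⟨R, hR⟩ : ∃ R : Fin n → Fin n → Prop,
      ∀ x y, R x y ↔ π.SameCycle x y ∨ π.SameCycle (μ₀ x) y := ⟨_, fun _ _ => Iff.rfl⟩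
  have Rrefl : ∀ x, R x x := fun x => (hR x x).2 (Or.inl (SameCycle.refl _ _))
  have Rsymm : ∀ x y, R x y → R y x := fun x y h => (hR y x).2 (by
    rcases (hR x y).1 h with h | h
    · exact Or.inl h.symm
    · have h' := sameCycle_map hc h
      rw [hμy] at h'
      exact Or.inr h'.symm)
  have Rtrans : ∀ x y z, R x y → R y z → R x z := fun x y z hxy hyz => (hR x z).2 (by
    rcases (hR x y).1 hxy with hxy | hxy <;> rcases (hR y z).1 hyz with hyz | hyz
    · exact Or.inl (hxy.trans hyz)
    · exact Or.inr ((sameCycle_map hc hxy).trans hyz)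
    · exact Or.inr (hxy.trans hyz)
    · have h' := sameCycle_map hc hxy
      rw [hμy] at h'
      exact Or.inl (h'.trans hyz))
  have Rsat : ∀ {y z}, R y z → ∀ x, (R x z ↔ R x y) := fun h x =>
    ⟨fun h' => Rtrans _ _ _ h' (Rsymm _ _ h), fun h' => Rtrans _ _ _ h' h⟩
  have Rμ : ∀ y, R y (μ₀ y) := fun y => (hR _ _).2 (Or.inr (SameCycle.refl _ _))
  have Rπ : ∀ y, R y (π y) := fun y =>
    (hR _ _).2 (Or.inl (sameCycle_apply_right.2 (SameCycle.refl _ _)))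
  have Re : ∀ y, R y (e y) := fun y => (hR _ _).2 (ecls y)
  -- classes have at most `2t` points; a transversal `T` with `n ≤ |T| (2t)`
  have hcls : ∀ x, ∃ s : Finset (Fin n), (∀ y, R x y → y ∈ s) ∧ s.card ≤ 2 * t := fun x => by
    obtain ⟨s₁, h₁, c₁⟩ := exists_cover_sameCycle π ht hct x
    obtain ⟨s₂, h₂, c₂⟩ := exists_cover_sameCycle π ht hct (μ₀ x)
    refine ⟨s₁ ∪ s₂, fun y hy => ?_, (Finset.card_union_le _ _).trans (by omega)⟩
    rcases (hR x y).1 hy with h | h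
    · exact Finset.mem_union_left _ (h₁ y h)
    · exact Finset.mem_union_right _ (h₂ y h)
  obtain ⟨T, hT, hcardT⟩ := exists_transversal R Rrefl Rsymm Rtrans hcls
  -- the permutations `G S`, `S ⊆ T`
  have bij : ∀ S : Finset (Fin n),
      Function.Bijective (fun y => if ∃ x ∈ S, R x y then e y else y) := fun S => by
    have hinj : Function.Injective (fun y => if ∃ x ∈ S, R x y then e y else y) :=
      piecewise_injective e (fun y => ∃ x ∈ S, R x y) einj
        (fun y => exists_congr fun x => and_congr_right fun _ => Rsat (Re y) x)
    exact ⟨hinj, Finite.surjective_of_injective hinj⟩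
  obtain ⟨G, Gapp⟩ : ∃ G : Finset (Fin n) → Equiv.Perm (Fin n),
      ∀ S y, G S y = if ∃ x ∈ S, R x y then e y else y :=
    ⟨fun S => Equiv.ofBijective _ (bij S), fun _ _ => rfl⟩
  have Gmem : ∀ S, G S ∈ (Subgroup.centralizer {μ₀} : Subgroup (Equiv.Perm (Fin n))) ⊓
      Subgroup.centralizer {μ₂} := fun S => by
    have cμ : G S * μ₀ = μ₀ * G S := by
      ext y
      have hq : (∃ x ∈ S, R x (μ₀ y)) ↔ ∃ x ∈ S, R x y :=
        exists_congr fun x => and_congr_right fun _ => Rsat (Rμ y) x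
      rw [Perm.mul_apply, Perm.mul_apply, Gapp, Gapp, if_congr hq rfl rfl]
      by_cases h : ∃ x ∈ S, R x y
      · rw [if_pos h, if_pos h, eμ]
      · rw [if_neg h, if_neg h]
    have cπ : G S * π = π * G S := by
      ext y
      have hq : (∃ x ∈ S, R x (π y)) ↔ ∃ x ∈ S, R x y :=
        exists_congr fun x => and_congr_right fun _ => Rsat (Rπ y) x
      rw [Perm.mul_apply, Perm.mul_apply, Gapp, Gapp, if_congr hq rfl rfl]
      by_cases h : ∃ x ∈ S, R x y
      · rw [if_pos h, if_pos h, eπ]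
      · rw [if_neg h, if_neg h]
    refine Subgroup.mem_inf.2 ⟨Subgroup.mem_centralizer_singleton_iff.2 cμ,
      Subgroup.mem_centralizer_singleton_iff.2 ?_⟩
    rw [hμ2, ← mul_assoc, cμ, mul_assoc, cπ, ← mul_assoc]
  -- `S ↦ G S` is injective on subsets of `T`
  have Gsub : ∀ S₁ S₂ : Finset (Fin n), S₁ ⊆ T → S₂ ⊆ T → G S₁ = G S₂ → S₁ ⊆ S₂ := by
    intro S₁ S₂ h₁ h₂ hG x hx
    have key : G S₂ x ≠ x := by
      rw [← hG, Gapp, if_pos ⟨x, hx, Rrefl x⟩]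
      exact efpf x
    rw [Gapp] at key
    by_cases hq : ∃ x' ∈ S₂, R x' x
    · obtain ⟨x', hx', hr⟩ := hq
      exact hT x' (h₂ hx') x (h₁ hx) hr ▸ hx'
    · exact absurd (if_neg hq) key
  have Finj : Function.Injective (fun S : ↥T.powerset =>
      (⟨G S.1, Gmem S.1⟩ : ↥((Subgroup.centralizer {μ₀} : Subgroup (Equiv.Perm (Fin n))) ⊓
        Subgroup.centralizer {μ₂}))) := by
    rintro ⟨S₁, h₁⟩ ⟨S₂, h₂⟩ h
    have h' : G S₁ = G S₂ := congrArg Subtype.val h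
    rw [Finset.mem_powerset] at h₁ h₂
    exact Subtype.ext (Finset.Subset.antisymm (Gsub _ _ h₁ h₂ h') (Gsub _ _ h₂ h₁ h'.symm))
  have hle := Nat.card_le_card_of_injective _ Finj
  rw [Nat.card_eq_finsetCard, Finset.card_powerset] at hle
  refine le_trans (Nat.pow_le_pow_right (by norm_num) (Nat.div_le_of_le_mul ?_)) hle
  rw [Fintype.card_fin] at hcardT
  rwa [mul_comm] at hcardT

end Summit.MatrixMultiplication.MatrixMultiplication.Theorems.HyperoctahedralSubsets
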